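import Mathlib.NumberTheory.Padics.PadicIntegers
import Mathlib.Topology.Instances.Matrix
import Mathlib.Analysis.SpecificLimits.Basic
import Mathlib.Algebra.Ring.Parity
import Mathlib.LinearAlgebra.Matrix.GeneralLinearGroup.Defs
import Mathlib.NumberTheory.Padics.RingHoms
import Summits.BirchSwinnertonDyer.BirchSwinnertonDyer.Theorems.UniversalToricDescentCentralElementH1Vanishing

/-!
# `-1` lies in every closed subgroup of `GL_n(ℤ_p)` that meets `-1 + p·M_n(ℤ_p)` (`p` odd), and Howard's H.2 at `p = 3`
# under mod-`p` surjectivity alone: `H¹(G, 𝔽_pⁿ) = 0`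

Support algebra for the crux `TwinAlgMuZeroAtThree` (stmt-BirchSwinnertonDyer-24737, R2 text of record; formerly 24254),
Kolyvagin-system road (`Cruxes/TwinAlgMuZeroAtThree/Ideas/local-indivisibility-road.md`; audit `AuditKSHypothesesAtThree-g53.md` Δ1;
LEAD memo `LEAD-utd-p1-g20-support-and-buckets.md` §1: «g53's profinite step (closed `G ≤ GL₂(ℤ₃)`, no continuous cohomology in
Mathlib) — not typable / not done»). Width prover `bsd-wall-utd-p1-w2` g7, `--supports stmt-BirchSwinnertonDyer-24737`.

Howard 2004 (Compositio 140, hypotheses H.1–H.2, arXiv:1202.6340 p. 12) verifies H.2 = `H¹(K(E[p^∞])/K, E[p]) = 0` from FULL `p`-adic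
image; the twin hypothesis of the route is only `HasSurjectiveModNGaloisRep 3`. The audit's Δ1 argument replaces the full image by:
(finite core) the central involution `-1 ∈ GL₂(𝔽₃)` kills `H¹(GL₂(𝔽₃), 𝔽₃²)` (Sah; tree `…CentralElementH1Vanishing`), and (profinite
step) a Frattini-layer analysis of the pro-`3` kernel. THIS FILE types the profinite step by a SHORTER route that needs no continuous
cohomology and no Frattini layers: if the image `G ≤ GL_n(ℤ_p)` (`p` odd) is closed and its reduction contains `-1` (e.g. is onto),
then `-1 ∈ G` itself — because for `g = -(1 + pY) ∈ G` the powers `g^{p^k} = -(1 + pY)^{p^k}` converge to `-1`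
(`(1 + p^{k+1}Y)^p = 1 + p^{k+2}Y'`, pure ring algebra) — and then Sah's lemma with the CENTRAL element `-1 ∈ G` acting by `-1` on
`𝔽_pⁿ` gives `H¹(G, 𝔽_pⁿ) = 0` for ABSTRACT group cohomology (which contains the continuous `H¹` of a finite discrete module). Contents:

* §1 ring algebra (any `R`-algebra `A`): `exists_pow_eq_one_add_smul_add_sq_smul` (`(1 + cY)^i = 1 + (ic)Y + c²Z`),
  `exists_pow_prime_eq_one_add_smul`, `exists_pow_prime_pow_eq_one_add_smul` (`(1 + pY)^{p^k} = 1 + p^{k+1}Y_k`);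
* §2 `p`-adic matrices: `tendsto_one_add_smul_pow_prime_pow` (`(1 + pY)^{p^k} → 1` entrywise), `neg_one_mem_of_isClosed_of_mem`
  (closed submonoid of `M_n(ℤ_p)`, `p` odd, containing `g ≡ -1` contains `-1`), `neg_one_mem_of_isClosed_image` (subgroups of `GL_n(ℤ_p)`),
  `exists_eq_neg_one_add_smul_of_map_eq_neg_one` (reduction `= -1` ⇒ congruence shape);
* §3 cohomology: `subsingleton_H1_of_central_acts_neg` (Sah with `c = -1`, any `k` with `2 ∈ kˣ`),
  `subsingleton_H1_reduction_of_isClosed_of_neg_one_mod` and `subsingleton_H1_reduction_of_isClosed_of_surjective` — **Howard's H.2 core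
  at any odd `p` under mod-`p` surjectivity only**: `H¹(G, 𝔽_pⁿ) = 0` for every closed `G ≤ GL_n(ℤ_p)` mapping onto `GL_n(𝔽_p)`,
  `G` acting through reduction (the representation is spelled out; no definition is introduced).

THEOREMS ONLY; std axioms; no `sorry`; imports no `Theses` module. HONEST FRAMING: finite-group / `p`-adic algebra; the number-theoretic
identification `G = Gal(K(E′[3^∞])/K) ↪ GL₂(ℤ₃)` (compact hence closed image; onto `GL₂(𝔽₃)` when `ρ̄_{E′,3}` is onto and
`K ∩ ℚ(E′[3]) = ℚ`) is not made here; BSD is proved for no curve by this file. References: B. Howard, *The Heegner point Kolyvagin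
system*, Compositio Math. 140 (2004), hypotheses H.1–H.2 (p. 12 of arXiv:1202.6340); C.-H. Sah, J. Algebra 10 (1968) (the lemma; folklore
form); J.-P. Serre, *Abelian ℓ-adic representations*, IV (closed subgroups of `GL_n(ℤ_p)`, folklore).
-/

set_option autoImplicit false
set_option linter.dupNamespace false

namespace Summit.BirchSwinnertonDyer.BirchSwinnertonDyer.Theorems.UniversalToricDescentPadicClosedNegOne

open Filter Topology

section Algebra

variable {R A : Type*} [CommRing R] [Ring A] [Algebra R A]

/-- `(1 + c • Y)^i = 1 + (i c) • Y + c² • Z_i` in any `R`-algebra (binomial expansion to second order, by induction; `Y` need not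
commute with anything but itself). [folklore] -/
theorem exists_pow_eq_one_add_smul_add_sq_smul (c : R) (Y : A) (i : ℕ) :
    ∃ Z : A, (1 + c • Y) ^ i = 1 + ((i : R) * c) • Y + (c * c) • Z := by
  induction i with
  | zero => exact ⟨0, by simp⟩
  | succ i ih =>
    obtain ⟨Z, hZ⟩ := ih
    refine ⟨(i : R) • (Y * Y) + Z + c • (Z * Y), ?_⟩
    rw [pow_succ, hZ]
    simp only [mul_add, add_mul, mul_one, one_mul, smul_mul_smul_comm, smul_add, smul_smul, Nat.cast_succ]
    module

/-- One `p`-th power step: `(1 + p^{k+1} • Y)^p = 1 + p^{k+2} • Y'` (`Y' = Y + p^k • Z`). [folklore] -/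
theorem exists_pow_prime_eq_one_add_smul (p : ℕ) (k : ℕ) (Y : A) :
    ∃ Y' : A, (1 + ((p : R) ^ (k + 1)) • Y) ^ p = 1 + ((p : R) ^ (k + 2)) • Y' := by
  obtain ⟨Z, hZ⟩ := exists_pow_eq_one_add_smul_add_sq_smul ((p : R) ^ (k + 1)) Y p
  refine ⟨Y + ((p : R) ^ k) • Z, ?_⟩
  rw [hZ, smul_add, smul_smul, add_assoc]
  congr 2
  · rw [pow_succ (p : R) (k + 1), mul_comm]
  · congr 1
    ring

/-- Iterating: `(1 + p • Y)^{p^k} = 1 + p^{k+1} • Y_k` for every `k`. [folklore] -/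
theorem exists_pow_prime_pow_eq_one_add_smul (p : ℕ) (Y : A) (k : ℕ) :
    ∃ Yk : A, (1 + (p : R) • Y) ^ (p ^ k) = 1 + ((p : R) ^ (k + 1)) • Yk := by
  induction k with
  | zero => exact ⟨Y, by simp⟩
  | succ k ih =>
    obtain ⟨Yk, hYk⟩ := ih
    obtain ⟨Y', hY'⟩ := exists_pow_prime_eq_one_add_smul (R := R) p k Yk
    exact ⟨Y', by rw [pow_succ, pow_mul, hYk, hY']⟩

end Algebra

section Padic

variable {p : ℕ} [Fact p.Prime] {n : Type*} [Fintype n] [DecidableEq n]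

/-- `(1 + p • Y)^{p^k} → 1` in `M_n(ℤ_p)` (product topology): entry `(i,j)` of the difference is `p^{k+1} · (Y_k)_{ij}`, of norm
`≤ p^{-(k+1)} → 0`. [folklore] -/
theorem tendsto_one_add_smul_pow_prime_pow (Y : Matrix n n ℤ_[p]) :
    Tendsto (fun k : ℕ => (1 + (p : ℤ_[p]) • Y) ^ (p ^ k)) atTop (𝓝 1) := by
  refine tendsto_pi_nhds.mpr fun i => tendsto_pi_nhds.mpr fun j => ?_
  rw [tendsto_iff_norm_sub_tendsto_zero]
  have hbound : ∀ k : ℕ, ‖((1 + (p : ℤ_[p]) • Y) ^ (p ^ k)) i j - (1 : Matrix n n ℤ_[p]) i j‖ ≤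
      ((p : ℝ)⁻¹) ^ (k + 1) := by
    intro k
    obtain ⟨Yk, hYk⟩ := exists_pow_prime_pow_eq_one_add_smul (R := ℤ_[p]) p Y k
    rw [hYk, Matrix.add_apply, add_sub_cancel_left, Matrix.smul_apply, smul_eq_mul, norm_mul, norm_pow,
      PadicInt.norm_p]
    exact mul_le_of_le_one_right (pow_nonneg (inv_nonneg.mpr (Nat.cast_nonneg p)) _) (PadicInt.norm_le_one _)
  refine squeeze_zero (fun k => norm_nonneg _) hbound ?_
  have hp1 : ((p : ℝ)⁻¹) < 1 := inv_lt_one_of_one_lt₀ (by exact_mod_cast (Fact.out : p.Prime).one_lt)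
  have hp0 : 0 ≤ ((p : ℝ)⁻¹) := inv_nonneg.mpr (Nat.cast_nonneg p)
  have h := tendsto_pow_atTop_nhds_zero_of_lt_one hp0 hp1
  exact h.comp (tendsto_add_atTop_nat 1)

/-- **Core lemma.** A CLOSED submonoid `S ⊆ M_n(ℤ_p)` (`p` odd) containing some `g = -1 + p • Y` contains `-1`: `g = -(1 + p(-Y))`,
`g^{p^k} = -(1 + p(-Y))^{p^k}` (`p^k` odd) `→ -1`, and `S ∋ g^{p^k}` is closed. [folklore] -/
theorem neg_one_mem_of_isClosed_of_mem (hp : p ≠ 2) (S : Submonoid (Matrix n n ℤ_[p]))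
    (hS : IsClosed (S : Set (Matrix n n ℤ_[p]))) {g : Matrix n n ℤ_[p]} (hg : g ∈ S)
    (hred : ∃ Y : Matrix n n ℤ_[p], g = -1 + (p : ℤ_[p]) • Y) : (-1 : Matrix n n ℤ_[p]) ∈ S := by
  obtain ⟨Y, rfl⟩ := hred
  have hodd : Odd p := (Fact.out : p.Prime).odd_of_ne_two hp
  -- `g^(p^k) = -(1 + p • (-Y))^(p^k)`
  have hpow : ∀ k : ℕ, (-1 + (p : ℤ_[p]) • Y) ^ (p ^ k) = -((1 + (p : ℤ_[p]) • (-Y)) ^ (p ^ k)) := by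
    intro k
    have h1 : (-1 + (p : ℤ_[p]) • Y) = -(1 + (p : ℤ_[p]) • (-Y)) := by rw [smul_neg, neg_add, neg_neg]
    rw [h1, (hodd.pow).neg_pow]
  have hlim : Tendsto (fun k : ℕ => (-1 + (p : ℤ_[p]) • Y) ^ (p ^ k)) atTop (𝓝 (-1)) := by
    simp_rw [hpow]
    exact (tendsto_one_add_smul_pow_prime_pow (-Y)).neg
  exact hS.mem_of_tendsto hlim (Eventually.of_forall fun k => S.pow_mem hg _)

/-- **Units version.** A subgroup `G ≤ GL_n(ℤ_p)` (`p` odd) whose image in `M_n(ℤ_p)` is closed and which contains some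
`g ≡ -1 (mod p)` contains `-1`. (For `G` = the image of a Galois group, compactness gives the closedness.) [folklore] -/
theorem neg_one_mem_of_isClosed_image (hp : p ≠ 2) (G : Subgroup (GL n ℤ_[p]))
    (hG : IsClosed (((↑) : GL n ℤ_[p] → Matrix n n ℤ_[p]) '' (G : Set (GL n ℤ_[p]))))
    {g : GL n ℤ_[p]} (hg : g ∈ G) (hred : ∃ Y : Matrix n n ℤ_[p], (g : Matrix n n ℤ_[p]) = -1 + (p : ℤ_[p]) • Y) :
    (-1 : GL n ℤ_[p]) ∈ G := by
  let S : Submonoid (Matrix n n ℤ_[p]) := G.toSubmonoid.map (Units.coeHom (Matrix n n ℤ_[p]))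
  have hSset : (S : Set (Matrix n n ℤ_[p])) = ((↑) : GL n ℤ_[p] → Matrix n n ℤ_[p]) '' (G : Set (GL n ℤ_[p])) := by
    ext x; simp [S]
  have hS : IsClosed (S : Set (Matrix n n ℤ_[p])) := hSset ▸ hG
  have hgS : (g : Matrix n n ℤ_[p]) ∈ S := ⟨g, hg, rfl⟩
  have h := neg_one_mem_of_isClosed_of_mem hp S hS hgS hred
  obtain ⟨g', hg', hg'eq⟩ := h
  have : g' = -1 := Units.ext (by simpa using hg'eq)
  exact this ▸ hg'

end Padic

section Cohomology

open groupCohomology CategoryTheory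
  Summit.BirchSwinnertonDyer.BirchSwinnertonDyer.Theorems.UniversalToricDescentCentralElementH1Vanishing

universe u

/-- **Sah's lemma at `c = -1`.** If a central `z ∈ G` acts on the `k[G]`-module `A` by `-1` and `2 ∈ kˣ`, then `H¹(G, A) = 0`
(`sah_subsingleton_H1` of `…CentralElementH1Vanishing` with `c = -1`, `c - 1 = -2`). [folklore] -/
theorem subsingleton_H1_of_central_acts_neg {k G : Type u} [CommRing k] [Group G] (A : Rep k G) (h2 : IsUnit (2 : k))
    {z : G} (hz : ∀ g : G, g * z = z * g) (hρ : ∀ a : A, A.ρ z a = -a) : Subsingleton (H1 A) := by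
  refine sah_subsingleton_H1 A hz (c := -1) ?_ (fun a => by rw [hρ a, neg_one_smul])
  have : (-1 : k) - 1 = -2 := by norm_num
  rw [this]
  exact h2.neg

variable {p : ℕ} [Fact p.Prime] {n : Type} [Fintype n] [DecidableEq n]

/-- **Howard's H.2 core, abstract-cohomology form.** `p` odd; `G ≤ GL_n(ℤ_p)` with closed image in `M_n(ℤ_p)` containing some
`g ≡ -1 (mod p)`. Then `H¹(G, 𝔽_pⁿ) = 0` for the action of `G` through reduction mod `p` (the representation
`G → GL_n(ℤ_p) → GL_n(𝔽_p) → GL(𝔽_pⁿ)` spelled out): `-1 ∈ G` by `neg_one_mem_of_isClosed_image`, it is central, reduces to `-1`,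
and Sah applies (`2 ∈ 𝔽_pˣ`). At `p = 3`, `n = 2` this is hypothesis H.2 of Howard's Theorem for the twin `E′` granted only
that the `3`-adic image contains an element `≡ -1`. [cite: Howard2004, hypotheses H.1–H.2 (arXiv:1202.6340 p. 12)] -/
theorem subsingleton_H1_reduction_of_isClosed_of_neg_one_mod (hp : p ≠ 2) (G : Subgroup (GL n ℤ_[p]))
    (hG : IsClosed (((↑) : GL n ℤ_[p] → Matrix n n ℤ_[p]) '' (G : Set (GL n ℤ_[p]))))
    {g : GL n ℤ_[p]} (hg : g ∈ G) (hred : ∃ Y : Matrix n n ℤ_[p], (g : Matrix n n ℤ_[p]) = -1 + (p : ℤ_[p]) • Y) :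
    Subsingleton (H1 (Rep.of
      (((Units.coeHom ((n → ZMod p) →ₗ[ZMod p] (n → ZMod p))).comp
        (Matrix.GeneralLinearGroup.toLin.toMonoidHom :
          GL n (ZMod p) →* ((n → ZMod p) →ₗ[ZMod p] (n → ZMod p))ˣ)).comp
        ((Matrix.GeneralLinearGroup.map (PadicInt.toZMod (p := p))).comp G.subtype)))) := by
  have hneg : (-1 : GL n ℤ_[p]) ∈ G := neg_one_mem_of_isClosed_image hp G hG hg hred
  have h2 : IsUnit (2 : ZMod p) := by
    rw [isUnit_iff_ne_zero]
    intro h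
    have h' : ((2 : ℕ) : ZMod p) = 0 := by exact_mod_cast h
    rw [ZMod.natCast_eq_zero_iff] at h'
    exact hp ((Nat.prime_dvd_prime_iff_eq Fact.out Nat.prime_two).mp h')
  refine subsingleton_H1_of_central_acts_neg _ h2 (z := ⟨-1, hneg⟩) (fun g => Subtype.ext ?_) (fun a => ?_)
  · simp only [Subgroup.coe_mul]
    rw [mul_neg_one, neg_one_mul]
  · change (Matrix.GeneralLinearGroup.toLin (Matrix.GeneralLinearGroup.map (PadicInt.toZMod (p := p)) (-1 : GL n ℤ_[p])) :
        (n → ZMod p) →ₗ[ZMod p] (n → ZMod p)) a = -a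
    rw [Matrix.GeneralLinearGroup.coe_toLin]
    have hm : ((Matrix.GeneralLinearGroup.map (PadicInt.toZMod (p := p)) (-1 : GL n ℤ_[p]) : GL n (ZMod p)) :
        Matrix n n (ZMod p)) = -1 := by
      ext i j
      rw [Matrix.GeneralLinearGroup.map_apply]
      simp [Matrix.one_apply, apply_ite]
    rw [hm]
    simp

/-- From «`g` reduces to `-1`» to the congruence shape `g = -1 + p • Y` used above (`ker (ℤ_p → 𝔽_p) = (p)` entrywise). [folklore] -/
theorem exists_eq_neg_one_add_smul_of_map_eq_neg_one {g : GL n ℤ_[p]}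
    (h : Matrix.GeneralLinearGroup.map (PadicInt.toZMod (p := p)) g = -1) :
    ∃ Y : Matrix n n ℤ_[p], (g : Matrix n n ℤ_[p]) = -1 + (p : ℤ_[p]) • Y := by
  have hent : ∀ i j : n, ∃ y : ℤ_[p], (g : Matrix n n ℤ_[p]) i j + (1 : Matrix n n ℤ_[p]) i j = (p : ℤ_[p]) * y := by
    intro i j
    have hij : PadicInt.toZMod (p := p) ((g : Matrix n n ℤ_[p]) i j) = (-1 : Matrix n n (ZMod p)) i j := by
      have := congrArg (fun M : GL n (ZMod p) => (M : Matrix n n (ZMod p)) i j) h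
      simpa [Matrix.GeneralLinearGroup.map_apply] using this
    have hker : (g : Matrix n n ℤ_[p]) i j + (1 : Matrix n n ℤ_[p]) i j ∈
        RingHom.ker (PadicInt.toZMod (p := p) : ℤ_[p] →+* ZMod p) := by
      rw [RingHom.mem_ker, map_add, hij, Matrix.neg_apply, Matrix.one_apply, Matrix.one_apply]
      split_ifs <;> simp
    rw [PadicInt.ker_toZMod, PadicInt.maximalIdeal_eq_span_p, Ideal.mem_span_singleton'] at hker
    obtain ⟨y, hy⟩ := hker
    exact ⟨y, by rw [← hy, mul_comm]⟩
  choose Y hY using hent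
  refine ⟨Matrix.of fun i j => Y i j, ?_⟩
  ext i j
  rw [Matrix.add_apply, Matrix.smul_apply, Matrix.of_apply, smul_eq_mul, ← hY i j, Matrix.neg_apply]
  abel

/-- **Howard's H.2 at an odd prime under mod-`p` SURJECTIVITY only.** `G ≤ GL_n(ℤ_p)` (`p` odd) with closed image in `M_n(ℤ_p)`
whose reduction is ONTO `GL_n(𝔽_p)` (it suffices that `-1` is a reduction): `H¹(G, 𝔽_pⁿ) = 0` for the action through reduction.
This discharges the «full `p`-adic image» input of Howard 2004 Thm. 1/2 for H.2 at `p = 3` (Δ1 of the utd-idea g53 audit): Elkies'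
«surjective mod 3, not mod 9» curves are covered. [cite: Howard2004, hypotheses H.1–H.2 (arXiv:1202.6340 p. 12)] -/
theorem subsingleton_H1_reduction_of_isClosed_of_surjective (hp : p ≠ 2) (G : Subgroup (GL n ℤ_[p]))
    (hG : IsClosed (((↑) : GL n ℤ_[p] → Matrix n n ℤ_[p]) '' (G : Set (GL n ℤ_[p]))))
    (hsurj : ∀ h : GL n (ZMod p), ∃ g ∈ G, Matrix.GeneralLinearGroup.map (PadicInt.toZMod (p := p)) g = h) :
    Subsingleton (H1 (Rep.of
      (((Units.coeHom ((n → ZMod p) →ₗ[ZMod p] (n → ZMod p))).comp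
        (Matrix.GeneralLinearGroup.toLin.toMonoidHom :
          GL n (ZMod p) →* ((n → ZMod p) →ₗ[ZMod p] (n → ZMod p))ˣ)).comp
        ((Matrix.GeneralLinearGroup.map (PadicInt.toZMod (p := p))).comp G.subtype)))) := by
  obtain ⟨g, hg, hgm⟩ := hsurj (-1)
  exact subsingleton_H1_reduction_of_isClosed_of_neg_one_mod hp G hG hg (exists_eq_neg_one_add_smul_of_map_eq_neg_one hgm)

end Cohomology

end Summit.BirchSwinnertonDyer.BirchSwinnertonDyer.Theorems.UniversalToricDescentPadicClosedNegOne
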